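import Mathlib
import Summits.ValiantsHypothesis.ValiantsHypothesis.Theorems.NewtonUnitEquationsNewtonTauWeakCoreSplittingRel
import Summits.ValiantsHypothesis.ValiantsHypothesis.Theorems.NewtonUnitEquationsNewtonTauWeakTwoCoreChartRel
import Summits.ValiantsHypothesis.ValiantsHypothesis.Theorems.NewtonUnitEquationsNewtonTauWeakCoreRelabel

/-!
# The logarithmic base bound for `2^k`-core designs (lead c7, line `binomial-normal-form`, crux `NewtonTauWeak`)

`coreChart_logBound`: a design on `2^k` cores (`k ≥ 1`), read through any `V ⊆ Fin x`, has at most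
`2^{k-1}·(k+1)^{|V|}` lower-hull vertices — the kernel form of `f(c) ≤ 1 + ⌈log₂ c⌉` for the `c`-core
sign-design kill family (card `Cruxes/NewtonTauWeak/Lines/binomial-normal-form-c7.md` §9.1(b)): the kill
criterion of that family needs `c ≥ 2^{4^b}` cores against `T2(b)`.  Induction on `k`: base = P12
`stub_twoCoreChartRel`, step = relabel `Fin (2^k + 2^k) ≃ Fin (2^(k+1))` (P13 `stub_coreRelabel`), split
with P11 `stub_coreSplittingRel`, apply the induction hypothesis to both halves of every slice, and sum
`Σ_{W ⊆ V} ((k+1)^{|V∖W|} + (k+1)^{|W|}) = 2·(k+2)^{|V|}`.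
-/

-- Sub = Summit single-conjunct layout: the duplicated namespace component is mandated by the tree.
set_option linter.dupNamespace false

open scoped BigOperators

namespace Summit.ValiantsHypothesis.ValiantsHypothesis.Theorems.NewtonUnitEquationsNewtonTauWeak

namespace CoreLogBoundAux

/-- Powerset sum `Σ_{W ⊆ V} m^{|W|} = (m+1)^{|V|}`. -/
theorem sum_pow_card (x m : ℕ) (V : Finset (Fin x)) :
    ∑ W ∈ V.powerset, m ^ W.card = (m + 1) ^ V.card := by
  simpa using Finset.sum_pow_mul_eq_add_pow m 1 V

/-- Powerset sum `Σ_{W ⊆ V} m^{|V \ W|} = (m+1)^{|V|}`. -/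
theorem sum_pow_card_sdiff (x m : ℕ) (V : Finset (Fin x)) :
    ∑ W ∈ V.powerset, m ^ (V \ W).card = (m + 1) ^ V.card := by
  have h := Finset.sum_pow_mul_eq_add_pow 1 m V
  rw [add_comm 1 m] at h
  rw [← h]
  refine Finset.sum_congr rfl fun W hW => ?_
  rw [Finset.card_sdiff_of_subset (Finset.mem_powerset.mp hW), one_pow, one_mul]

/-- Arithmetic of the induction step: slice bounds `A W ≤ K m^{|V∖W|}`, `B W ≤ K m^{|W|}` sum to `2K(m+1)^{|V|}`. -/
theorem sum_step (x K m : ℕ) (V : Finset (Fin x)) (A B : Finset (Fin x) → ℕ)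
    (hA : ∀ W ∈ V.powerset, A W ≤ K * m ^ (V \ W).card) (hB : ∀ W ∈ V.powerset, B W ≤ K * m ^ W.card) :
    ∑ W ∈ V.powerset, (A W + B W) ≤ 2 * K * (m + 1) ^ V.card := by
  calc ∑ W ∈ V.powerset, (A W + B W)
      ≤ ∑ W ∈ V.powerset, (K * m ^ (V \ W).card + K * m ^ W.card) :=
        Finset.sum_le_sum fun W hW => Nat.add_le_add (hA W hW) (hB W hW)
    _ = K * (m + 1) ^ V.card + K * (m + 1) ^ V.card := by
        rw [Finset.sum_add_distrib, ← Finset.mul_sum, ← Finset.mul_sum, sum_pow_card_sdiff, sum_pow_card]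
    _ = 2 * K * (m + 1) ^ V.card := by ring

end CoreLogBoundAux

open CoreLogBoundAux

/-- **The logarithmic base bound.**  For `1 ≤ k`, every design `h` on `2^k` cores and every `V ⊆ Fin x`, the lower-hull
vertices (`σ = −1` chart points) of the cloud read through `V` number at most `2^{k−1}·(k+1)^{|V|}`:
`f(2^k) ≤ k + 1`, i.e. `f(c) ≤ 1 + ⌈log₂ c⌉` (Minkowski splitting iterated; card §9.1). -/
theorem coreChart_logBound (x k : ℕ) (hk : 1 ≤ k) :
    ∀ (V : Finset (Fin x)) (h : Fin (2 ^ k) → Finset (Fin x) → (Fin 2 →₀ ℕ)),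
      {p : Fin 2 →₀ ℕ | p ∈ (Finset.univ.image fun f : Fin x → Fin (2 ^ k) =>
            ∑ d, h d (V ∩ Finset.univ.filter fun u => f u = d)) ∧
          ∃ t : ℝ, ∀ q ∈ (Finset.univ.image fun f : Fin x → Fin (2 ^ k) =>
            ∑ d, h d (V ∩ Finset.univ.filter fun u => f u = d)), q ≠ p →
            t * ((q 0 : ℕ) : ℝ) + (-1) * ((q 1 : ℕ) : ℝ) < t * ((p 0 : ℕ) : ℝ) + (-1) * ((p 1 : ℕ) : ℝ)}.ncard ≤
        2 ^ (k - 1) * (k + 1) ^ V.card := by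
  induction k, hk using Nat.le_induction with
  | base =>
    intro V h
    have e : Fin 2 ≃ Fin (2 ^ 1) := finCongr (by norm_num)
    rw [← stub_coreRelabel (2 ^ 1) 2 x e V h]
    simpa using stub_twoCoreChartRel x V (fun d => h (e d))
  | succ n hn ih =>
    intro V h
    have e : Fin (2 ^ n + 2 ^ n) ≃ Fin (2 ^ (n + 1)) := finCongr (by ring)
    rw [← stub_coreRelabel (2 ^ (n + 1)) (2 ^ n + 2 ^ n) x e V h]
    have hsplit := stub_coreSplittingRel (2 ^ n) (2 ^ n) x Nat.one_le_two_pow Nat.one_le_two_pow V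
      (fun d => h (e d))
    have hA : ∀ W ∈ V.powerset,
        {p : Fin 2 →₀ ℕ | p ∈ (Finset.univ.image fun φ : Fin x → Fin (2 ^ n) =>
            ∑ d, (fun d => h (e d)) (Fin.castAdd (2 ^ n) d) ((V \ W) ∩ Finset.univ.filter fun u => φ u = d)) ∧
          ∃ t : ℝ, ∀ q ∈ (Finset.univ.image fun φ : Fin x → Fin (2 ^ n) =>
            ∑ d, (fun d => h (e d)) (Fin.castAdd (2 ^ n) d) ((V \ W) ∩ Finset.univ.filter fun u => φ u = d)), q ≠ p →
            t * ((q 0 : ℕ) : ℝ) + (-1) * ((q 1 : ℕ) : ℝ) < t * ((p 0 : ℕ) : ℝ) + (-1) * ((p 1 : ℕ) : ℝ)}.ncard ≤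
          2 ^ (n - 1) * (n + 1) ^ (V \ W).card :=
      fun W _ => ih (V \ W) (fun d => h (e (Fin.castAdd (2 ^ n) d)))
    have hB : ∀ W ∈ V.powerset,
        {p : Fin 2 →₀ ℕ | p ∈ (Finset.univ.image fun ψ : Fin x → Fin (2 ^ n) =>
            ∑ d, (fun d => h (e d)) (Fin.natAdd (2 ^ n) d) (W ∩ Finset.univ.filter fun u => ψ u = d)) ∧
          ∃ t : ℝ, ∀ q ∈ (Finset.univ.image fun ψ : Fin x → Fin (2 ^ n) =>
            ∑ d, (fun d => h (e d)) (Fin.natAdd (2 ^ n) d) (W ∩ Finset.univ.filter fun u => ψ u = d)), q ≠ p →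
            t * ((q 0 : ℕ) : ℝ) + (-1) * ((q 1 : ℕ) : ℝ) < t * ((p 0 : ℕ) : ℝ) + (-1) * ((p 1 : ℕ) : ℝ)}.ncard ≤
          2 ^ (n - 1) * (n + 1) ^ W.card :=
      fun W _ => ih W (fun d => h (e (Fin.natAdd (2 ^ n) d)))
    have hsum := sum_step x (2 ^ (n - 1)) (n + 1) V
      (fun W => {p : Fin 2 →₀ ℕ | p ∈ (Finset.univ.image fun φ : Fin x → Fin (2 ^ n) =>
            ∑ d, (fun d => h (e d)) (Fin.castAdd (2 ^ n) d) ((V \ W) ∩ Finset.univ.filter fun u => φ u = d)) ∧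
          ∃ t : ℝ, ∀ q ∈ (Finset.univ.image fun φ : Fin x → Fin (2 ^ n) =>
            ∑ d, (fun d => h (e d)) (Fin.castAdd (2 ^ n) d) ((V \ W) ∩ Finset.univ.filter fun u => φ u = d)), q ≠ p →
            t * ((q 0 : ℕ) : ℝ) + (-1) * ((q 1 : ℕ) : ℝ) < t * ((p 0 : ℕ) : ℝ) + (-1) * ((p 1 : ℕ) : ℝ)}.ncard)
      (fun W => {p : Fin 2 →₀ ℕ | p ∈ (Finset.univ.image fun ψ : Fin x → Fin (2 ^ n) =>
            ∑ d, (fun d => h (e d)) (Fin.natAdd (2 ^ n) d) (W ∩ Finset.univ.filter fun u => ψ u = d)) ∧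
          ∃ t : ℝ, ∀ q ∈ (Finset.univ.image fun ψ : Fin x → Fin (2 ^ n) =>
            ∑ d, (fun d => h (e d)) (Fin.natAdd (2 ^ n) d) (W ∩ Finset.univ.filter fun u => ψ u = d)), q ≠ p →
            t * ((q 0 : ℕ) : ℝ) + (-1) * ((q 1 : ℕ) : ℝ) < t * ((p 0 : ℕ) : ℝ) + (-1) * ((p 1 : ℕ) : ℝ)}.ncard)
      hA hB
    have h2 : 2 * 2 ^ (n - 1) = 2 ^ (n + 1 - 1) := by
      rw [Nat.add_sub_cancel, ← pow_succ', Nat.sub_add_cancel hn]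
    rw [h2] at hsum
    exact le_trans (le_trans (Nat.le_add_right _ _) hsplit) hsum
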